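import Summits.HubbardSuperconductivity.HubbardSuperconductivity.Theorems.AnisotropyChordTransferFibre3RowDLoopWNorms
import Summits.HubbardSuperconductivity.HubbardSuperconductivity.Theorems.AnisotropyChordTransferFibre3RowDRhoBound

/-!
# Route `AnisotropyChord` / H0 rotor rung, row D (KT-2a) Stage 1.5: the hat-unit majorant `RExpr`s with a GENERIC zone-constant atom

Continuation of `…RowDLoopW` / `…RowDLoopWNorms`: the `RExpr` mirrors of `…RowDLoopMajE` and the norm bound of `…RowDRhoBound`
with the zone constant `c_Z` (atom `cZE`) replaced by an ARBITRARY atom `czE : RExpr` evaluating to a constant `cz` that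
satisfies the gradient-slot hypothesis: ★ `bnd3EC`, ★ `bpgEC` (+ `eval_bnd3EC`, `eval_bpgEC`: `↦ bnd3AtC cz/(V³t)`,
`bpgAtC cz/(V³t)`), ★ `lineBndEC`, `majNEC`, `majBEC`, ★ `majLoopEC`, ★ `majEC` (the `NT` part `majNTE` and the plain tables
`bndME`, `bspE` carry no zone constant and are reused), ★ `monoLoop_leC`, ★ `loopTot_leC`, ★★ `rhat_norm_leC`:
`‖R̂′(k̄)‖ ≤ V²t·(|x_k| + majEC czE)` — the input of the generic cell check `…RowDCellCheckW`.
Prover seat `hubbard-h0-rotor-p1` g31 (route lead); helper for piece A = stmt-HubbardSuperconductivity-23918 of rung 19089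
(`--supports`, helper class).  Nothing here proves superconductivity in the Hubbard model; lemmas for ONE row of ONE conditional
reduction.  Tree imports only; no sorry.
-/

set_option linter.dupNamespace false
set_option autoImplicit false

open scoped BigOperators
open Literature.Analysis.ValidatedNumerics

namespace Summit.HubbardSuperconductivity.HubbardSuperconductivity.Theorems.AnisotropyChord.Transfer.Fibre3

namespace RowD

open RowC L2.N1

variable (L : ℕ) [NeZero L]

/-! ## The tables with a generic zone-constant atom -/

/-- ★ N-type table `/(V³t)` with a generic zone-constant atom `czE` in place of `cZE`. -/
def bnd3EC (czE : RExpr) (ku kw kw' : Bool) : RExpr :=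
  match ku, kw, kw' with
  | true, true, true => .mul (.mul (.mul (.mul (.mul cs cs) cs) czE) vS2) K3E
  | true, true, false => .mul (.mul (.mul (.mul cs cs) (.mul (cst 2) vA)) (.sqrt (.mul (.mul (.mul czE vS2) S1h) vT))) K3E
  | true, false, true => .mul (.mul (.mul (.mul cs cs) (.mul (cst 2) vA)) (.sqrt (.mul (.mul (.mul czE vS2) S1h) vT))) K3E
  | true, false, false => .mul (.mul (.mul (.mul cs (.sq (.mul (cst 2) vA))) S1h) vT) K3E
  | false, true, true => .mul (.mul (.mul (.mul (.mul vA (.mul cs cs)) czE) S1h) vT) K3E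
  | false, true, false => .mul (.mul (.mul (.mul (.mul vA cs) (.mul (cst 2) vA)) (.sqrt (.mul (.mul czE S1h) (.mul (cst 4) vPi2)))) vT) K3E
  | false, false, true => .mul (.mul (.mul (.mul (.mul vA cs) (.mul (cst 2) vA)) (.sqrt (.mul (.mul czE S1h) (.mul (cst 4) vPi2)))) vT) K3E
  | false, false, false => .mul (.mul (.mul (.mul vA (.sq (.mul (cst 2) vA))) (.mul (cst 4) vPi2)) vT) K3E

/-- ★ plain × gradient pair table `/(V³t)` with a generic zone-constant atom `czE` in place of `cZE`. -/
def bpgEC (czE : RExpr) (k k' : Bool) : RExpr :=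
  match k, k' with
  | true, true => .mul (.mul (.mul cs cs) (.sqrt (.mul (.mul (.mul czE vS2) S1h) vT))) K3E
  | true, false => .mul (.mul (.mul (.mul cs (.mul (cst 2) vA)) S1h) vT) K3E
  | false, true => .mul (.mul (.mul (.mul vA cs) (.sqrt (.mul (.mul czE S1h) (.mul (cst 4) vPi2)))) vT) K3E
  | false, false => .mul (.mul (.mul (.mul vA (.mul (cst 2) vA)) (.mul (cst 4) vPi2)) vT) K3E


section evals
variable (Δ lam2 : ℝ) (f : Tor L → ℝ)

/-- ★ `bnd3EC czE ↦ bnd3AtC cz/(V³t)` when `czE ↦ cz`. [folklore] -/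
theorem eval_bnd3EC (czE : RExpr) {cz : ℝ} (hcz : czE.eval (xTrueD L Δ lam2 f) = cz) (hL : 128 ≤ L) (hΔ0 : 0 ≤ Δ) (hΔ1 : Δ < 1) (hf : IsGroundTwoMagnon L Δ lam2 f) (ku kw kw' : Bool) :
    (bnd3EC czE ku kw kw').eval (xTrueD L Δ lam2 f) = bnd3AtC L Δ lam2 f cz ku kw kw' / (((L : ℝ) ^ 2) ^ 3 * (2 * Real.pi / L) ^ 2) := by
  obtain ⟨h0, h1, h3, h4, hcs, hS1, -, -, hK3, hV⟩ := atom_facts L Δ lam2 f hL hΔ0 hΔ1 hf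
  have hLpos : (0 : ℝ) < L := by exact_mod_cast (show 0 < L by omega)
  have ht : 0 < (2 * Real.pi / L : ℝ) ^ 2 := by positivity
  have hπ : Real.pi ≠ 0 := Real.pi_ne_zero
  unfold bnd3AtC bnd3
  rw [hV]
  cases ku <;> cases kw <;> cases kw' <;>
    simp only [bnd3EC, RExpr.eval, cst, vA, vS2, vT, vPi2, h0, h1, h3, h4, hcs, hS1, hcz, hK3]
  · push_cast
    field_simp
  · push_cast
    rw [sqrt_hat2 ht]
    generalize Real.sqrt (cz * S1n L lam2 * (4 * Real.pi ^ 2 / (2 * Real.pi / ↑L) ^ 2)) = sq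
    field_simp
  · push_cast
    rw [sqrt_hat2 ht]
    generalize Real.sqrt (cz * S1n L lam2 * (4 * Real.pi ^ 2 / (2 * Real.pi / ↑L) ^ 2)) = sq
    field_simp
  · field_simp
  · push_cast
    field_simp
  · push_cast
    rw [sqrt_hat1]
    generalize Real.sqrt (cz * S2n L lam2 * S1n L lam2) = sq
    field_simp
  · push_cast
    rw [sqrt_hat1]
    generalize Real.sqrt (cz * S2n L lam2 * S1n L lam2) = sq
    field_simp
  · field_simp


/-- ★ `bpgEC czE ↦ bpgAtC cz/(V³t)` when `czE ↦ cz`. [folklore] -/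
theorem eval_bpgEC (czE : RExpr) {cz : ℝ} (hcz : czE.eval (xTrueD L Δ lam2 f) = cz) (hL : 128 ≤ L) (hΔ0 : 0 ≤ Δ) (hΔ1 : Δ < 1) (hf : IsGroundTwoMagnon L Δ lam2 f) (k k' : Bool) :
    (bpgEC czE k k').eval (xTrueD L Δ lam2 f) = bpgAtC L Δ lam2 f cz k k' / (((L : ℝ) ^ 2) ^ 3 * (2 * Real.pi / L) ^ 2) := by
  obtain ⟨h0, h1, h3, h4, hcs, hS1, -, -, hK3, hV⟩ := atom_facts L Δ lam2 f hL hΔ0 hΔ1 hf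
  have hLpos : (0 : ℝ) < L := by exact_mod_cast (show 0 < L by omega)
  have ht : 0 < (2 * Real.pi / L : ℝ) ^ 2 := by positivity
  have hπ : Real.pi ≠ 0 := Real.pi_ne_zero
  unfold bpgAtC bpg
  rw [hV]
  cases k <;> cases k' <;>
    simp only [bpgEC, RExpr.eval, cst, vA, vS2, vT, vPi2, h0, h1, h3, h4, hcs, hS1, hcz, hK3]
  · push_cast
    field_simp
  · push_cast
    rw [sqrt_hat2 ht]
    generalize Real.sqrt (cz * S1n L lam2 * (4 * Real.pi ^ 2 / (2 * Real.pi / ↑L) ^ 2)) = sq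
    field_simp
  · push_cast
    field_simp
  · rw [sqrt_hat1]
    generalize Real.sqrt (cz * S2n L lam2 * S1n L lam2) = sq
    field_simp


end evals

/-! ## The majorant `RExpr`s -/

/-- one boundary line `/(V³t)`, generic zone-constant atom: `6(bpgE x y + bpgE y x) + 2√t·bspE y x`. -/
def lineBndEC (czE : RExpr) (x y : Bool) : RExpr :=
  .add (.mul (cst 6) (.add (bpgEC czE x y) (bpgEC czE y x))) (.mul (.mul (cst 2) (.sqrt vT)) (bspE y x))

/-- the N-part majorant of a monomial `/(V³t)`, generic zone-constant atom. -/
def majNEC (czE : RExpr) (k3 k1 k2 : Bool) : RExpr :=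
  .mul (cst 6) (.add (.add (bnd3EC czE k3 k1 k2) (bnd3EC czE k2 k3 k1)) (bnd3EC czE k1 k3 k2))

/-- the boundary-part majorant of a monomial, generic zone-constant atom. -/
def majBEC (czE : RExpr) (k3 k1 k2 : Bool) : RExpr :=
  .add (.add (.mul (pvE k1) (lineBndEC czE k3 k2)) (.mul (pvE k2) (lineBndEC czE k3 k1))) (.mul (pvE k3) (lineBndEC czE k2 k1))

/-- ★ the loop majorant of the class `(k₂,k₃)`, generic zone-constant atom: `Σ_{monoList} (majNE + majME + majBE)`. -/
def majLoopEC (czE : RExpr) (k₂ k₃ : ℤ × ℤ) : RExpr :=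
  sumE (monoList.map (fun m => .add (.add (majNEC czE m.2.2 m.1 m.2.1) (majME m.2.2 m.1 m.2.1 k₂ k₃)) (majBEC czE m.2.2 m.1 m.2.1)))

/-- ★ THE MAJORANT of the class `(k₂,k₃)`, generic zone-constant atom (the `NT` part carries no zone constant). -/
def majEC (czE : RExpr) (τlo τhi : ℚ) (k₂ k₃ : ℤ × ℤ) : RExpr := .add (majLoopEC czE k₂ k₃) (majNTE τlo τhi k₂ k₃)

/-! ## The bound -/

section bound
variable (Δ lam2 : ℝ) (f : Tor L → ℝ)

/-- ★ one monomial, generic zone constant: `‖monoLoopU(k̄)‖ ≤ V²t·(majNEC + majME + majBEC).eval`. [folklore] -/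
theorem monoLoop_leC (czE : RExpr) {cz : ℝ} (hc : 0 ≤ cz)
    (hwg : ∀ q : Tor L, ∀ e ∈ E4, (wnorm L q (B1.toTor L e) * gres L lam2 q) ^ 2 ≤ cz * gres L lam2 q)
    (hcz : czE.eval (xTrueD L Δ lam2 f) = cz) (hL : 128 ≤ L) (hΔ0 : 0 ≤ Δ) (hΔ1 : Δ < 1) (hf : IsGroundTwoMagnon L Δ lam2 f) (e0 : Tor L)
    (k3 k1 k2 : Bool) (k₂ k₃ : ℤ × ℤ) :
    ‖monoLoopU L Δ lam2 f e0 k3 k1 k2 (B1.toTor L k₂) (B1.toTor L k₃)‖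
      ≤ ((L : ℝ) ^ 2) ^ 2 * (2 * Real.pi / L) ^ 2 *
        (RExpr.add (.add (majNEC czE k3 k1 k2) (majME k3 k1 k2 k₂ k₃)) (majBEC czE k3 k1 k2)).eval (xTrueD L Δ lam2 f) := by
  have hLpos : (0 : ℝ) < L := by exact_mod_cast (show 0 < L by omega)
  have hθ : 0 < (2 * Real.pi / L : ℝ) := by positivity
  have hV : (0 : ℝ) < (L : ℝ) ^ 2 := by positivity
  -- the three semantic bounds
  have hN := norm_nvLoopU_leC L Δ lam2 f hc hwg hL hΔ0 hΔ1 hf k3 k1 k2 e0 (B1.toTor L k₂) (B1.toTor L k₃)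
  have hM := norm_mLoopU_le L Δ lam2 f hL hΔ0 hΔ1 hf k3 k1 k2 e0 k₂ k₃
  have hB := norm_bLoopU_leC L Δ lam2 f hc hwg hL hΔ0 hΔ1 hf k3 k1 k2 (B1.toTor L k₂) (B1.toTor L k₃)
  -- the eval identities
  have e3 := fun (a b c' : Bool) => eval_bnd3EC L Δ lam2 f czE hcz hL hΔ0 hΔ1 hf a b c'
  have eM := eval_bndME L Δ lam2 f hL hΔ0 hΔ1 hf k3 k1 k2
  have epg := fun (a b : Bool) => eval_bpgEC L Δ lam2 f czE hcz hL hΔ0 hΔ1 hf a b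
  have esp := fun (a b : Bool) => eval_bspE L Δ lam2 f hL hΔ0 hΔ1 hf a b
  have epv := fun (k : Bool) => eval_pvE L Δ lam2 f k
  have hsqrt : Real.sqrt (xTrueD L Δ lam2 f 0) = 2 * Real.pi / L := by rw [xTrueD_zero, Real.sqrt_sq hθ.le]
  have hline : ∀ x y : Bool, ((L : ℝ) ^ 2) ^ 2 * (2 * Real.pi / L) ^ 2 * (lineBndEC czE x y).eval (xTrueD L Δ lam2 f) = lineBndC L Δ lam2 f cz x y / (L : ℝ) ^ 2 := by
    intro x y
    simp only [lineBndEC, RExpr.eval, cst, vT, epg, esp, hsqrt]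
    unfold lineBndC
    push_cast
    field_simp
  have hNE : ((L : ℝ) ^ 2) ^ 2 * (2 * Real.pi / L) ^ 2 * (majNEC czE k3 k1 k2).eval (xTrueD L Δ lam2 f) = 6 * (bnd3SumC L Δ lam2 f cz k3 k1 k2 / (L : ℝ) ^ 2) := by
    simp only [majNEC, RExpr.eval, cst, e3]
    unfold bnd3SumC
    push_cast
    field_simp
  have hME : ((L : ℝ) ^ 2) ^ 2 * (2 * Real.pi / L) ^ 2 * (majME k3 k1 k2 k₂ k₃).eval (xTrueD L Δ lam2 f)
      = (2 * Real.pi / L) ^ 2 * (mMult k₂ k₃ : ℝ) * (bndMAt L Δ lam2 f k3 k1 k2 / (L : ℝ) ^ 2) := by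
    simp only [majME, RExpr.eval, cst, eM]
    push_cast
    field_simp
  have hBE : ((L : ℝ) ^ 2) ^ 2 * (2 * Real.pi / L) ^ 2 * (majBEC czE k3 k1 k2).eval (xTrueD L Δ lam2 f)
      = (pvR L Δ lam2 f k1 * lineBndC L Δ lam2 f cz k3 k2 + pvR L Δ lam2 f k2 * lineBndC L Δ lam2 f cz k3 k1
          + pvR L Δ lam2 f k3 * lineBndC L Δ lam2 f cz k2 k1) / (L : ℝ) ^ 2 := by
    have h1 := hline k3 k2; have h2 := hline k3 k1; have h3 := hline k2 k1
    simp only [majBEC, RExpr.eval, epv]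
    linear_combination (pvR L Δ lam2 f k1) * h1 + (pvR L Δ lam2 f k2) * h2 + (pvR L Δ lam2 f k3) * h3
  unfold monoLoopU
  calc ‖nvLoopU L Δ lam2 f k3 k1 k2 e0 (B1.toTor L k₂) (B1.toTor L k₃) + mLoopU L Δ lam2 f k3 k1 k2 e0 (B1.toTor L k₂) (B1.toTor L k₃)
        - bLoopU L Δ lam2 f k3 k1 k2 (B1.toTor L k₂) (B1.toTor L k₃)‖
      ≤ ‖nvLoopU L Δ lam2 f k3 k1 k2 e0 (B1.toTor L k₂) (B1.toTor L k₃)‖ + ‖mLoopU L Δ lam2 f k3 k1 k2 e0 (B1.toTor L k₂) (B1.toTor L k₃)‖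
        + ‖bLoopU L Δ lam2 f k3 k1 k2 (B1.toTor L k₂) (B1.toTor L k₃)‖ := by
        refine (norm_sub_le _ _).trans ?_; gcongr; exact norm_add_le _ _
    _ ≤ _ := by
        rw [RExpr.eval, RExpr.eval, mul_add, mul_add, hNE, hME, hBE]
        linarith

/-- ★ the total loop part, generic zone constant: `‖loopTot(k̄)‖ ≤ V²t·(majLoopEC czE k).eval`. [folklore] -/
theorem loopTot_leC (czE : RExpr) {cz : ℝ} (hc : 0 ≤ cz)
    (hwg : ∀ q : Tor L, ∀ e ∈ E4, (wnorm L q (B1.toTor L e) * gres L lam2 q) ^ 2 ≤ cz * gres L lam2 q)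
    (hcz : czE.eval (xTrueD L Δ lam2 f) = cz) (hL : 128 ≤ L) (hΔ0 : 0 ≤ Δ) (hΔ1 : Δ < 1) (hf : IsGroundTwoMagnon L Δ lam2 f) (e0 : Tor L) (k₂ k₃ : ℤ × ℤ) :
    ‖loopTot L Δ lam2 f e0 (B1.toTor L k₂) (B1.toTor L k₃)‖
      ≤ ((L : ℝ) ^ 2) ^ 2 * (2 * Real.pi / L) ^ 2 * (majLoopEC czE k₂ k₃).eval (xTrueD L Δ lam2 f) := by
  have T := fun (k3 k1 k2 : Bool) => monoLoop_leC L Δ lam2 f czE hc hwg hcz hL hΔ0 hΔ1 hf e0 k3 k1 k2 k₂ k₃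
  unfold loopTot majLoopEC
  rw [eval_sumE]
  simp only [monoList, List.map, List.sum_cons, List.sum_nil, add_zero, mul_add]
  have e1 := T true false false; have e2 := T false false true; have e3 := T true false true
  have e4 := T false true false; have e5 := T true true false; have e6 := T false true true; have e7 := T true true true
  exact norm_add_le_of_le e1 (norm_add_le_of_le e2 (norm_add_le_of_le e3 (norm_add_le_of_le e4
    (norm_add_le_of_le e5 (norm_add_le_of_le e6 e7)))))

/-- ★★ THE NORM BOUND of a low coefficient with a GENERIC zone constant (ground profile located in a row-D cell, `L ≥ 128`; `τlo·θ² ≤ T⁺ ≤ τhi·θ²`; `rhoOk k`). -/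
theorem rhat_norm_leC (czE : RExpr) {cz : ℝ} (hc : 0 ≤ cz)
    (hwg : ∀ q : Tor L, ∀ e ∈ E4, (wnorm L q (B1.toTor L e) * gres L lam2 q) ^ 2 ≤ cz * gres L lam2 q)
    (hcz : czE.eval (xTrueD L Δ lam2 f) = cz) (hL : 128 ≤ L) (hΔ0 : 0 ≤ Δ) (hΔ1 : Δ < 1) (hf : IsGroundTwoMagnon L Δ lam2 f)
    (τlo τhi : ℚ) (hτlo : (τlo : ℝ) * (2 * Real.pi / L) ^ 2 ≤ Tplus L Δ f) (hτhi : Tplus L Δ f ≤ (τhi : ℝ) * (2 * Real.pi / L) ^ 2)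
    {k₂ k₃ : ℤ × ℤ} (hok : rhoOk k₂ k₃ = true) :
    ‖cfgDFT L (resid L Δ f) (B1.toTor L k₂) (B1.toTor L k₃)‖
      ≤ ((L : ℝ) ^ 2) ^ 2 * (2 * Real.pi / L) ^ 2 *
        (|(rhoE k₂ k₃).1.eval (xTrueD L Δ lam2 f)| + (majEC czE τlo τhi k₂ k₃).eval (xTrueD L Δ lam2 f)) := by
  have hLpos : (0 : ℝ) < L := by exact_mod_cast (show 0 < L by omega)
  have hθ : 0 < (2 * Real.pi / L : ℝ) := by positivity
  have ht : 0 < (2 * Real.pi / L : ℝ) ^ 2 := by positivity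
  have hV : (0 : ℝ) < (L : ℝ) ^ 2 := by positivity
  have hlam : 0 < lam2 := lam2_pos L (by omega) hΔ1 hf.1
  have hreal := rhat_norm_eq_abs_re L hf (B1.toTor L k₂) (B1.toTor L k₃)
  rw [hreal, rhat_decomp_eval L Δ lam2 f (by omega) hΔ0 hΔ1 hf hlam 0 hok]
  have hnV : ‖((L : ℂ) ^ 2) ^ 2‖ = ((L : ℝ) ^ 2) ^ 2 := by rw [norm_pow, norm_pow]; simp
  -- piece A: the closed pair, real part
  have hA : (((L : ℂ) ^ 2) ^ 2 * ((((2 * Real.pi / L) ^ 2 : ℝ) : ℂ) * peval (2 * Real.pi / L) (xTrueD L Δ lam2 f) (rhoE k₂ k₃))).re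
      = ((L : ℝ) ^ 2) ^ 2 * (2 * Real.pi / L) ^ 2 * (rhoE k₂ k₃).1.eval (xTrueD L Δ lam2 f) := by
    unfold peval
    simp only [Complex.mul_re, Complex.add_re, Complex.ofReal_re, Complex.ofReal_im, Complex.mul_im, Complex.I_re, Complex.I_im,
      Complex.add_im]
    have : (((L : ℂ) ^ 2) ^ 2).re = ((L : ℝ) ^ 2) ^ 2 ∧ (((L : ℂ) ^ 2) ^ 2).im = 0 := by
      constructor
      · norm_cast
      · norm_cast
    rw [this.1, this.2]
    ring
  -- piece B: the loops
  have hB := loopTot_leC L Δ lam2 f czE hc hwg hcz hL hΔ0 hΔ1 hf 0 k₂ k₃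
  -- piece C: the NT term
  have hν2 : xTrueD L Δ lam2 f 2 = lam2 / (2 * Real.pi / L) ^ 2 := xTrueD_two L Δ lam2 f
  have hτ : |Tplus L Δ f - 3 * lam2| ≤ (2 * Real.pi / L) ^ 2 * (tdevE τlo τhi).eval (xTrueD L Δ lam2 f) := by
    simp only [tdevE, RExpr.eval, cst, vNu, hν2]
    push_cast
    have h3 : Tplus L Δ f - 3 * lam2
        = (2 * Real.pi / L) ^ 2 * (Tplus L Δ f / (2 * Real.pi / L) ^ 2 - 3 * (lam2 / (2 * Real.pi / L) ^ 2)) := by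
      field_simp
    rw [h3, abs_mul, abs_of_pos ht]
    refine mul_le_mul_of_nonneg_left ?_ ht.le
    apply abs_le_max_abs_abs
    · have : (τlo : ℝ) ≤ Tplus L Δ f / (2 * Real.pi / L) ^ 2 := by rw [le_div_iff₀ ht]; exact hτlo
      linarith
    · have : Tplus L Δ f / (2 * Real.pi / L) ^ 2 ≤ (τhi : ℝ) := by rw [div_le_iff₀ ht]; exact hτhi
      linarith
  have hC : ‖(((Tplus L Δ f - 3 * lam2 : ℝ) : ℂ))
        * (((L : ℂ) ^ 2) ^ 2 * ((((ntClosedE k₂ k₃).eval (xTrueD L Δ lam2 f) : ℝ)) : ℂ) + ntLoopU L Δ lam2 f 0 (B1.toTor L k₂) (B1.toTor L k₃))‖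
      ≤ ((L : ℝ) ^ 2) ^ 2 * (2 * Real.pi / L) ^ 2 * (majNTE τlo τhi k₂ k₃).eval (xTrueD L Δ lam2 f) := by
    rw [norm_mul, Complex.norm_real, Real.norm_eq_abs]
    have hin : ‖((L : ℂ) ^ 2) ^ 2 * ((((ntClosedE k₂ k₃).eval (xTrueD L Δ lam2 f) : ℝ)) : ℂ) + ntLoopU L Δ lam2 f 0 (B1.toTor L k₂) (B1.toTor L k₃)‖
        ≤ ((L : ℝ) ^ 2) ^ 2 * (|(ntClosedE k₂ k₃).eval (xTrueD L Δ lam2 f)| + 3 * ntBndE.eval (xTrueD L Δ lam2 f)) := by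
      have h1 : ‖((L : ℂ) ^ 2) ^ 2 * ((((ntClosedE k₂ k₃).eval (xTrueD L Δ lam2 f) : ℝ)) : ℂ)‖ = ((L : ℝ) ^ 2) ^ 2 * |(ntClosedE k₂ k₃).eval (xTrueD L Δ lam2 f)| := by
        rw [norm_mul, Complex.norm_real, Real.norm_eq_abs, hnV]
      have h2 := ntLoop_le L Δ lam2 f hL hΔ0 hΔ1 hf 0 (B1.toTor L k₂) (B1.toTor L k₃)
      refine (norm_add_le _ _).trans ?_
      rw [h1]
      linarith
    have hdev0 : 0 ≤ (2 * Real.pi / L) ^ 2 * (tdevE τlo τhi).eval (xTrueD L Δ lam2 f) := le_trans (abs_nonneg _) hτ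
    calc |Tplus L Δ f - 3 * lam2| * ‖((L : ℂ) ^ 2) ^ 2 * ((((ntClosedE k₂ k₃).eval (xTrueD L Δ lam2 f) : ℝ)) : ℂ) + ntLoopU L Δ lam2 f 0 (B1.toTor L k₂) (B1.toTor L k₃)‖
        ≤ ((2 * Real.pi / L) ^ 2 * (tdevE τlo τhi).eval (xTrueD L Δ lam2 f)) * (((L : ℝ) ^ 2) ^ 2 * (|(ntClosedE k₂ k₃).eval (xTrueD L Δ lam2 f)| + 3 * ntBndE.eval (xTrueD L Δ lam2 f))) :=
          mul_le_mul hτ hin (norm_nonneg _) hdev0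
      _ = ((L : ℝ) ^ 2) ^ 2 * (2 * Real.pi / L) ^ 2 * (majNTE τlo τhi k₂ k₃).eval (xTrueD L Δ lam2 f) := by
          simp only [majNTE, RExpr.eval, cst]; push_cast; ring
  -- assemble: `|Re(A + B − C)| ≤ |Re A| + ‖B‖ + ‖C‖`
  simp only [majEC, RExpr.eval]
  rw [Complex.sub_re, Complex.add_re, hA]
  have hBre := (Complex.abs_re_le_norm (loopTot L Δ lam2 f 0 (B1.toTor L k₂) (B1.toTor L k₃))).trans hB
  have hCre := (Complex.abs_re_le_norm ((((Tplus L Δ f - 3 * lam2 : ℝ) : ℂ))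
        * (((L : ℂ) ^ 2) ^ 2 * ((((ntClosedE k₂ k₃).eval (xTrueD L Δ lam2 f) : ℝ)) : ℂ)
          + ntLoopU L Δ lam2 f 0 (B1.toTor L k₂) (B1.toTor L k₃)))).trans hC
  have hVt : 0 ≤ ((L : ℝ) ^ 2) ^ 2 * (2 * Real.pi / L) ^ 2 := by positivity
  have hx : |((L : ℝ) ^ 2) ^ 2 * (2 * Real.pi / L) ^ 2 * (rhoE k₂ k₃).1.eval (xTrueD L Δ lam2 f)|
      = ((L : ℝ) ^ 2) ^ 2 * (2 * Real.pi / L) ^ 2 * |(rhoE k₂ k₃).1.eval (xTrueD L Δ lam2 f)| := by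
    rw [abs_mul, abs_of_nonneg hVt]
  have habs := abs_sub (((L : ℝ) ^ 2) ^ 2 * (2 * Real.pi / L) ^ 2 * (rhoE k₂ k₃).1.eval (xTrueD L Δ lam2 f)
      + (loopTot L Δ lam2 f 0 (B1.toTor L k₂) (B1.toTor L k₃)).re)
    ((((Tplus L Δ f - 3 * lam2 : ℝ) : ℂ)) * (((L : ℂ) ^ 2) ^ 2 * ((((ntClosedE k₂ k₃).eval (xTrueD L Δ lam2 f) : ℝ)) : ℂ)
        + ntLoopU L Δ lam2 f 0 (B1.toTor L k₂) (B1.toTor L k₃))).re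
  have hadd := abs_add_le (((L : ℝ) ^ 2) ^ 2 * (2 * Real.pi / L) ^ 2 * (rhoE k₂ k₃).1.eval (xTrueD L Δ lam2 f))
    (loopTot L Δ lam2 f 0 (B1.toTor L k₂) (B1.toTor L k₃)).re
  rw [hx] at hadd
  linarith [habs, hadd, hBre, hCre]

end bound

end RowD

end Summit.HubbardSuperconductivity.HubbardSuperconductivity.Theorems.AnisotropyChord.Transfer.Fibre3
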